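import Summits.NavierStokesRegularity.NavierStokesRegularity.Theorems.TerminalTraceTypeITraceScarL3SqrtTwoCalculus

/-!
# ROUND-28 calculus plate — the LOG-MEAN frequency threshold (theorems only)

Sequel to `TerminalTraceTypeITraceScarL3SqrtTwoCalculus` (p599226).  The landed lemma
`one_le_exponent_of_frequencyODE` says: a positive extinct `E` with Dirichlet-quotient law
`Λ' ≤ (p/(−s) + a₀(−s)^{-1/2})Λ + b₀(−s)^{-1/2}` forces the CONSTANT exponent `p ≥ 1`.  Here the
exponent is a FUNCTION `p(s) ≥ 0` (in the Navier–Stokes application `p(s) = (−s)·sup|V(s,·)|²/2`, half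
the squared instantaneous Type-I constant) and the hypothesis is only on its LOGARITHMIC WINDOW MEANS:
with `P' = p/(−s)`, `P(s) − P(s') ≤ q·log((−s')/(−s)) + K₀` for `s' ≤ s` (every log-time window has
mean `≤ q` up to the additive slack `K₀`).  Conclusion: `q ≥ 1`.  So extinction is excluded as soon as the
uniform log-window mean of `(−s)|V|²_∞` is `< 2`, even if the instantaneous constant exceeds `√2` on a
log-sparse set of times (for a discretely self-similar apex: the PERIOD MEAN, not the peak).
Proof: integrating factor `exp(−(P − P(s₂)) + 2a₀(√(−s) − √(−s₂)))` gives `Λ ≤ K(−s)^{-q'}`,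
`q' = max q ½`, and the landed lemma applied to the majorant `K(−s)^{-q'}` gives `q' ≥ 1`.

WHAT THIS IS NOT: pure real analysis; no statement about Navier–Stokes.  [folklore; Agmon–Nirenberg 1967;
Ghidaglia 1986; this file: the variable-exponent form]
-/

open Set Filter Topology

set_option linter.dupNamespace false

namespace Summit.NavierStokesRegularity.NavierStokesRegularity.Theorems.TypeITraceScarL3

/-- **Log-mean frequency threshold.**  If `E > 0`, `Λ ≥ 0` on `]s₁,0[` satisfy
`E' ≥ −2ΛE − g₀(−s)^{-1/2}E`, `Λ' ≤ (p(s)/(−s) + a₀(−s)^{-1/2})Λ + b₀(−s)^{-1/2}` with `p ≥ 0`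
continuous enough to have a primitive `P` of `p/(−s)`, the log-window means of `p` are `≤ q` up to slack
`K₀` (`P s − P s' ≤ q·log((−s')/(−s)) + K₀` for `s' ≤ s`), and `E → 0` as `s → 0⁻`, then `1 ≤ q`.
[folklore; variable-exponent form of `one_le_exponent_of_frequencyODE`] -/
theorem one_le_logMeanExponent_of_frequencyODE :
    ∀ (q K₀ a₀ b₀ g₀ s₁ : ℝ) (E Λ E' Λ' p P : ℝ → ℝ), s₁ < 0 → 0 ≤ a₀ → 0 ≤ b₀ → 0 ≤ g₀ → 0 ≤ K₀ →
      (∀ s ∈ Ioo s₁ 0, 0 < E s) → (∀ s ∈ Ioo s₁ 0, 0 ≤ Λ s) →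
      (∀ s ∈ Ioo s₁ 0, HasDerivAt E (E' s) s) → (∀ s ∈ Ioo s₁ 0, HasDerivAt Λ (Λ' s) s) →
      (∀ s ∈ Ioo s₁ 0, 0 ≤ p s) → (∀ s ∈ Ioo s₁ 0, HasDerivAt P (p s / (-s)) s) →
      (∀ s' ∈ Ioo s₁ 0, ∀ s ∈ Ioo s₁ 0, s' ≤ s →
        P s - P s' ≤ q * Real.log ((-s') / (-s)) + K₀) →
      (∀ s ∈ Ioo s₁ 0, -2 * Λ s * E s - g₀ / Real.sqrt (-s) * E s ≤ E' s) →
      (∀ s ∈ Ioo s₁ 0, Λ' s ≤ (p s / (-s) + a₀ / Real.sqrt (-s)) * Λ s + b₀ / Real.sqrt (-s)) →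
      Tendsto E (𝓝[<] 0) (𝓝 0) →
      1 ≤ q := by
  intro q K₀ a₀ b₀ g₀ s₁ E Λ E' Λ' p P hs₁ ha₀ hb₀ hg₀ hK₀ hEpos hΛnn hE hΛ hpnn hP hwin hE' hΛ' hext
  by_contra hq
  push Not at hq
  set q' : ℝ := max q (1 / 2) with hq'_def
  have hq'1 : q' < 1 := max_lt hq (by norm_num)
  have hqq' : q ≤ q' := le_max_left _ _
  have hq'pos : 0 < q' := lt_of_lt_of_le (by norm_num) (le_max_right _ _)
  have hneg : ∀ s ∈ Ioo s₁ 0, 0 < -s := fun s hs => by linarith [hs.2]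
  -- the base time `s₂ ∈ ]s₁, 0[` with `-s₂ ≤ 1/2`
  set s₂ : ℝ := max (s₁ / 2) (-1 / 2) with hs₂_def
  have hs₂mem : s₂ ∈ Ioo s₁ 0 := by
    refine ⟨lt_of_lt_of_le (by linarith) (le_max_left _ _), ?_⟩
    rw [hs₂_def]; exact max_lt (by linarith) (by norm_num)
  have hs₂le : -s₂ ≤ 1 / 2 := by
    have : -1 / 2 ≤ s₂ := le_max_right _ _
    linarith
  have hs₂pos : 0 < -s₂ := hneg s₂ hs₂mem
  -- ## integrating factor
  set μ : ℝ → ℝ := fun s =>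
    Real.exp ((P s₂ - P s) + 2 * a₀ * (Real.sqrt (-s) - Real.sqrt (-s₂))) with hμ_def
  have hμpos : ∀ s, 0 < μ s := fun s => Real.exp_pos _
  have hμder : ∀ s ∈ Ioo s₁ 0,
      HasDerivAt μ (-(p s / (-s) + a₀ / Real.sqrt (-s)) * μ s) s := by
    intro s hs
    have hs0 : -s ≠ 0 := (hneg s hs).ne'
    have hsq : 0 < Real.sqrt (-s) := Real.sqrt_pos.mpr (hneg s hs)
    have h1 : HasDerivAt (fun x : ℝ => P s₂ - P x) (-(p s / (-s))) s :=
      (hP s hs).const_sub (P s₂)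
    have h2 : HasDerivAt (fun s : ℝ => Real.sqrt (-s)) ((-1) / (2 * Real.sqrt (-s))) s :=
      (hasDerivAt_neg s).sqrt hs0
    have h3 : HasDerivAt (fun s : ℝ => 2 * a₀ * (Real.sqrt (-s) - Real.sqrt (-s₂)))
        (2 * a₀ * ((-1) / (2 * Real.sqrt (-s)))) s :=
      (h2.sub_const _).const_mul _
    have h4 : HasDerivAt μ _ s := (h1.add h3).exp
    refine h4.congr_deriv ?_
    simp only [hμ_def, Pi.add_apply]
    have hsq' : Real.sqrt (-s) ≠ 0 := hsq.ne'
    field_simp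
    ring
  -- `μ ≤ 1` on `[s₂, 0)` : `P` is nondecreasing and `√(-s) ≤ √(-s₂)`
  have hPmono : ∀ s ∈ Ico s₂ 0, P s₂ ≤ P s := by
    intro s hs
    rcases eq_or_lt_of_le hs.1 with h | h
    · rw [h]
    · -- mean value with lower bound `0 ≤ P'` on `Icc s₂ s`
      have hsub : Icc s₂ s ⊆ Ioo s₁ 0 := fun x hx => ⟨lt_of_lt_of_le hs₂mem.1 hx.1, lt_of_le_of_lt hx.2 hs.2⟩
      have hcont : ContinuousOn P (Icc s₂ s) := fun x hx =>
        (hP x (hsub hx)).continuousAt.continuousWithinAt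
      have hdiff : DifferentiableOn ℝ P (interior (Icc s₂ s)) := by
        rw [interior_Icc]; exact fun x hx => (hP x (hsub (Ioo_subset_Icc_self hx))).differentiableAt.differentiableWithinAt
      have hder : ∀ x ∈ interior (Icc s₂ s), (0 : ℝ) ≤ deriv P x := by
        rw [interior_Icc]; intro x hx
        have hx' := hsub (Ioo_subset_Icc_self hx)
        rw [(hP x hx').deriv]
        exact div_nonneg (hpnn x hx') (hneg x hx').le
      have hmv := (convex_Icc s₂ s).mul_sub_le_image_sub_of_le_deriv hcont hdiff hder
        s₂ (left_mem_Icc.mpr h.le) s (right_mem_Icc.mpr h.le) h.le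
      linarith
  have hμle : ∀ s ∈ Ico s₂ 0, μ s ≤ 1 := by
    intro s hs
    have h1 := hPmono s hs
    have h2 : Real.sqrt (-s) ≤ Real.sqrt (-s₂) := Real.sqrt_le_sqrt (by linarith [hs.1])
    have : (P s₂ - P s) + 2 * a₀ * (Real.sqrt (-s) - Real.sqrt (-s₂)) ≤ 0 := by nlinarith
    calc μ s = Real.exp ((P s₂ - P s) + 2 * a₀ * (Real.sqrt (-s) - Real.sqrt (-s₂))) := rfl
      _ ≤ Real.exp 0 := Real.exp_le_exp.mpr this
      _ = 1 := Real.exp_zero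
  -- ## `F = μ Λ + 2 b₀ √(-s)` is non-increasing on `[s₂, 0)`
  set F : ℝ → ℝ := fun s => μ s * Λ s + 2 * b₀ * Real.sqrt (-s) with hF_def
  have hFder : ∀ s ∈ Ioo s₁ 0, HasDerivAt F
      (-(p s / (-s) + a₀ / Real.sqrt (-s)) * μ s * Λ s + μ s * Λ' s +
        2 * b₀ * ((-1) / (2 * Real.sqrt (-s)))) s := by
    intro s hs
    have hs0 : -s ≠ 0 := (hneg s hs).ne'
    have h2 : HasDerivAt (fun s : ℝ => Real.sqrt (-s)) ((-1) / (2 * Real.sqrt (-s))) s :=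
      (hasDerivAt_neg s).sqrt hs0
    exact ((hμder s hs).mul (hΛ s hs)).add (h2.const_mul _)
  have hFder_le : ∀ s ∈ Ioo s₂ 0,
      -(p s / (-s) + a₀ / Real.sqrt (-s)) * μ s * Λ s + μ s * Λ' s +
        2 * b₀ * ((-1) / (2 * Real.sqrt (-s))) ≤ 0 := by
    intro s hs
    have hs' : s ∈ Ioo s₁ 0 := ⟨lt_trans hs₂mem.1 hs.1, hs.2⟩
    have hs0 : 0 < -s := hneg s hs'
    have hsq : 0 < Real.sqrt (-s) := Real.sqrt_pos.mpr hs0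
    have hμs := hμpos s
    have hμ1 := hμle s ⟨hs.1.le, hs.2⟩
    have h := hΛ' s hs'
    have step1 : μ s * Λ' s ≤ μ s * ((p s / (-s) + a₀ / Real.sqrt (-s)) * Λ s + b₀ / Real.sqrt (-s)) :=
      mul_le_mul_of_nonneg_left h hμs.le
    have step2 : μ s * (b₀ / Real.sqrt (-s)) ≤ 1 * (b₀ / Real.sqrt (-s)) :=
      mul_le_mul_of_nonneg_right hμ1 (div_nonneg hb₀ hsq.le)
    have step3 : 2 * b₀ * ((-1) / (2 * Real.sqrt (-s))) = -(b₀ / Real.sqrt (-s)) := by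
      field_simp
    nlinarith [step1, step2, step3]
  have hFanti : ∀ s ∈ Ico s₂ 0, F s ≤ F s₂ := by
    intro s hs
    rcases eq_or_lt_of_le hs.1 with h | h
    · rw [h]
    · have hsub : Icc s₂ s ⊆ Ioo s₁ 0 := fun x hx => ⟨lt_of_lt_of_le hs₂mem.1 hx.1, lt_of_le_of_lt hx.2 hs.2⟩
      have hcont : ContinuousOn F (Icc s₂ s) := fun x hx =>
        (hFder x (hsub hx)).continuousAt.continuousWithinAt
      have hdiff : DifferentiableOn ℝ F (interior (Icc s₂ s)) := by
        rw [interior_Icc]; exact fun x hx => (hFder x (hsub (Ioo_subset_Icc_self hx))).differentiableAt.differentiableWithinAt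
      have hder : ∀ x ∈ interior (Icc s₂ s), deriv F x ≤ 0 := by
        rw [interior_Icc]; intro x hx
        rw [(hFder x (hsub (Ioo_subset_Icc_self hx))).deriv]
        exact hFder_le x ⟨hx.1, lt_of_lt_of_le hx.2 hs.2.le⟩
      have hmv := (convex_Icc s₂ s).image_sub_le_mul_sub_of_deriv_le hcont hdiff hder
        s₂ (left_mem_Icc.mpr h.le) s (right_mem_Icc.mpr h.le) h.le
      linarith
  -- ## the bound `Λ ≤ K (-s)^(-q')` on `[s₂, 0)`
  set K₁ : ℝ := F s₂ with hK₁_def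
  have hK₁nn : 0 ≤ K₁ := by
    have h1 : 0 ≤ μ s₂ * Λ s₂ := mul_nonneg (hμpos s₂).le (hΛnn s₂ hs₂mem)
    have h2 : 0 ≤ 2 * b₀ * Real.sqrt (-s₂) := by positivity
    simpa [hK₁_def, hF_def] using add_nonneg h1 h2
  set K : ℝ := K₁ * Real.exp (K₀ + 2 * a₀ * Real.sqrt (-s₂)) * (-s₂) ^ q' with hK_def
  have hKnn : 0 ≤ K := by
    have : 0 ≤ (-s₂) ^ q' := Real.rpow_nonneg hs₂pos.le _
    positivity
  have hΛbd : ∀ s ∈ Ico s₂ 0, Λ s ≤ K * (-s) ^ (-q') := by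
    intro s hs
    have hs' : s ∈ Ioo s₁ 0 := ⟨lt_of_lt_of_le hs₂mem.1 hs.1, hs.2⟩
    have hs0 : 0 < -s := hneg s hs'
    -- `μ s * Λ s ≤ K₁`
    have h1 : μ s * Λ s ≤ K₁ := by
      have := hFanti s hs
      have h2 : 0 ≤ 2 * b₀ * Real.sqrt (-s) := by positivity
      simp only [hF_def, hK₁_def] at this ⊢
      linarith
    -- `1 / μ s ≤ exp(K₀ + 2 a₀ √(-s₂)) * ((-s₂)/(-s))^q'`
    have hratio : 1 ≤ (-s₂) / (-s) := by
      rw [le_div_iff₀ hs0]; linarith [hs.1]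
    have hwin' : P s - P s₂ ≤ q * Real.log ((-s₂) / (-s)) + K₀ := hwin s₂ hs₂mem s hs' hs.1
    have hlogle : q * Real.log ((-s₂) / (-s)) ≤ q' * Real.log ((-s₂) / (-s)) :=
      mul_le_mul_of_nonneg_right hqq' (Real.log_nonneg hratio)
    have hexp : 1 / μ s ≤ Real.exp (K₀ + 2 * a₀ * Real.sqrt (-s₂)) * ((-s₂) / (-s)) ^ q' := by
      have e1 : 1 / μ s = Real.exp ((P s - P s₂) - 2 * a₀ * (Real.sqrt (-s) - Real.sqrt (-s₂))) := by
        rw [hμ_def, one_div, ← Real.exp_neg]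
        congr 1; ring
      have e2 : (P s - P s₂) - 2 * a₀ * (Real.sqrt (-s) - Real.sqrt (-s₂))
          ≤ (K₀ + 2 * a₀ * Real.sqrt (-s₂)) + q' * Real.log ((-s₂) / (-s)) := by
        have : 0 ≤ 2 * a₀ * Real.sqrt (-s) := by positivity
        linarith
      have e3 : Real.exp ((K₀ + 2 * a₀ * Real.sqrt (-s₂)) + q' * Real.log ((-s₂) / (-s)))
          = Real.exp (K₀ + 2 * a₀ * Real.sqrt (-s₂)) * ((-s₂) / (-s)) ^ q' := by
        rw [Real.exp_add, Real.rpow_def_of_pos (lt_of_lt_of_le one_pos hratio)]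
        congr 1; ring_nf
      rw [e1, ← e3]
      exact Real.exp_le_exp.mpr e2
    have hdivpow : ((-s₂) / (-s)) ^ q' = (-s₂) ^ q' * (-s) ^ (-q') := by
      rw [Real.div_rpow hs₂pos.le hs0.le, Real.rpow_neg hs0.le, div_eq_mul_inv]
    -- assemble
    have hμs := hμpos s
    calc Λ s = (μ s * Λ s) * (1 / μ s) := by field_simp
      _ ≤ K₁ * (Real.exp (K₀ + 2 * a₀ * Real.sqrt (-s₂)) * ((-s₂) / (-s)) ^ q') :=
          mul_le_mul h1 hexp (by positivity) hK₁nn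
      _ = K * (-s) ^ (-q') := by rw [hdivpow, hK_def]; ring
  -- ## the landed constant-exponent lemma applied to the majorant `K (-s)^(-q')` on `]s₂, 0[`
  have hmain := one_le_exponent_of_frequencyODE q' 0 0 g₀ s₂ E (fun s => K * (-s) ^ (-q')) E'
    (fun s => K * (q' * (-s) ^ (-q' - 1))) hs₂mem.2 le_rfl le_rfl hg₀
    (fun s hs => hEpos s ⟨lt_trans hs₂mem.1 hs.1, hs.2⟩)
    (fun s hs => mul_nonneg hKnn (Real.rpow_nonneg (by linarith [hs.2]) _))
    (fun s hs => hE s ⟨lt_trans hs₂mem.1 hs.1, hs.2⟩)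
    (fun s hs => by
      have hs0 : -s ≠ 0 := by linarith [hs.2]
      have h1 : HasDerivAt (fun s : ℝ => (-s) ^ (-q')) ((-1) * (-q') * (-s) ^ (-q' - 1)) s :=
        (hasDerivAt_neg s).rpow_const (Or.inl hs0)
      have h2 := h1.const_mul K
      refine h2.congr_deriv ?_
      ring)
    (fun s hs => by
      have hs' : s ∈ Ioo s₁ 0 := ⟨lt_trans hs₂mem.1 hs.1, hs.2⟩
      have h1 := hE' s hs'
      have h2 := hΛbd s ⟨hs.1.le, hs.2⟩
      have h3 := hEpos s hs'
      nlinarith)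
    (fun s hs => by
      have hs0 : 0 < -s := by linarith [hs.2]
      have e : K * (q' * (-s) ^ (-q' - 1)) = (q' / (-s) + 0 / Real.sqrt (-s)) * (K * (-s) ^ (-q')) + 0 / Real.sqrt (-s) := by
        rw [Real.rpow_sub_one hs0.ne' (-q')]
        field_simp
        ring
      exact e.le)
    hext
  linarith

end Summit.NavierStokesRegularity.NavierStokesRegularity.Theorems.TypeITraceScarL3
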